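import Summits.QuantumFields.BalabanUV.Beta.EriceFlowEnclosureB12AsPrintedWitness
import Literature.MathematicalPhysics.QuantumFieldTheory.Balaban1983to89.BetaDerivClause

/-!
# Beta / EriceFlowEnclosureB12AsPrintedHistoryJump — the CONTINUITY LETTER of Theorem 2 on the as-printed interface of [I], part 1:
# a family of β-functions carrying EVERY last-variable letter and EVERY size letter the cell's Theorem-2 reductions use, whose
# dependence on the PRECEDING couplings is arbitrary (β-flow team, prover 1 = recursion ∕ upper ∕ bare-coupling ∕ uniqueness side,
# unit `b2b-balaban-beta-bflow-p1`, gen 33; ROW AP-I; PART 2 = `…B12AsPrintedHistoryJumpRuns` (the runs and ¬Theorem 2), PART 3 =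
# `…B12AsPrintedHistoryJumpEnd` (one explicit jump, the toy setting, the headlines); companions `…B12AsPrintedUpper` §3 (the reductions
# `theorem2Statement_of_letters ∕ _of_pertH ∕ _of_split`, each with the binder `FlowStep.BetaContH`), an4's
# `B12AsPrintedRowD4JunctionThm2` (`theorem2Statement_of_faceLetters ∕ _of_uniform264`, same binder), `…B12AsPrintedLastVar` (row I1))

HONEST FRAMING (page 1 of everything the β sub-cell writes): discharging `BetaPertH` makes Bałaban's UV stability UNCONDITIONAL — a
real constructive-QFT result; it is NOT the continuum limit and NOT the Clay problem.  HONEST DEPENDENCY (cell reorg 2026-08-19,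
verbatim): «continuum YM on T⁴ ⇐ BetaPertH ∧ nine spine estimates (0/9 proved); BetaPertH ⇐ (D1) ∧ (D4) ∧ CAP+tail; G-an2-4 gates
asym, D1 and NE2/3/4.»  THIS MODULE DISCHARGES NOTHING: [folklore] calculus on ONE two-parameter family of functions of ours, read
through the NAMED FIELDS of the statement-exact typing of [I] = T. Bałaban, Commun. Math. Phys. **109** (1987) [Balaban1987RG1]
(`B12BetaAsPrinted`, p537882 ✓ ∕ v1.1 p539116 ✓) and the tree's located letters.  Every statement is about settings `S` satisfying a
DEFINING HYPOTHESIS `hβ`; nothing of Bałaban's β_{j+1} is asserted and the family is not claimed to resemble it.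

THE QUESTION.  Every reduction of [I]'s Theorem 2 AS PRINTED (`B12BetaAsPrinted.Theorem2Statement`) landed on this carrier —
`…B12AsPrintedUpper.theorem2Statement_of_letters ∕ _of_pertH ∕ _of_split`, `B12AsPrintedRowD4JunctionThm2.theorem2Statement_of_faceLetters ∕
_of_uniform264`, `…B12AsPrintedLowerEnd.endpoint_of_sign` — carries the binder (C) = `FlowStep.BetaContH γ S.β`: JOINT continuity of
β_{k+1}(g₀, …, g_k) in ALL its couplings, the input of the forward shooting in the bare coupling (`FlowStep.continuousOn_Y`).  Print
gives regularity in the LAST coupling only — p. 264, after (1.22): *"It is a smooth function defined on the interval [0, γ], (or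
analytic), uniformly bounded on this interval together with all derivatives"* (`Conclusions.c264`; the cell's readings
`B12CouplingClausesHistory.BetaSmoothInLast264 ∕ BetaAnalyticInLast264 ∕ BetaDerivsBoundedInLast264 ∕ BetaDerivsUniformInLast264`,
`BetaDerivClause.LastVarLipschitz ∕ LastVarLipschitzAtZero`) — and says of the preceding couplings only that the dependence exists
(p. 298: *"We write β_j as explicitly dependent on g_{j−1}, although it depends also on all preceding coupling constants"*).  Can (C)
be weakened to what print says?  PARTS 1–3 answer NO with a kernel witness; `…B12AsPrintedHistoryJumpMarkov` records what replaces
(C) in the literal Markov reading «β_{k+1}(g_k)» of (0.20), and that p. 266's PLURAL (*"analytic functions of the effective coupling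
constants"*, typed `BetaAnalyticInCouplings266` — not a conjunct of `c264`, which carries the last-variable clause under the flag
`altCutoff266`) is the one printed sentence that would supply it.

THE FAMILY (parameters b > 0 and an arbitrary J : ℝ → ℝ with 0 ≤ J(x) ≤ x²): β₁(g₀) := b; β₂(g₀, g₁) := b + J(g₀)·g₁; β_{k+1} := b
for k ≥ 2 — in the tree's indexing `S.β k p = b + (if k = 1 then J (p 0) else 0)·p (Fin.last k)`.  Its last-variable sections are
AFFINE with slope ≤ g₀² ≤ γ², so every last-variable letter holds with k-UNIFORM constants, the one-loop face value is b, and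
|β_{k+1} − b| ≤ γ³ on ]0, γ]^{k+1} (`FlowStep.BetaPertH S.β b` with C = 1); NOTHING constrains J's continuity.

WHAT THIS FILE PROVES (0 sorry, 0 def):
§1 `iteratedDerivWithin_affine` (all derivatives of s ↦ b + a·s within [0, γ]); under `hβ`: `beta_eq`, `section_eq`, `face_eq`.
§2 THE LETTERS, under `hβ` with 0 ≤ J ≤ x²: `betaSmoothInLast264_of_histJump`, `betaAnalyticInLast264_of_histJump`,
   **`betaDerivsUniformInLast264_of_histJump`** (table (b + γ³, γ², 0, 0, …) — the j- AND history-UNIFORM reading of p. 264, all orders),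
   `betaDerivsBoundedInLast264_of_histJump`, **`c264_of_histJump`** (the clause AS TYPED along every run, INCLUDING its analytic member under the
   p. 266 flag), **`lastVarLipschitz_of_histJump`** (row I1's k-uniform letter, C = γ²), `lastVarLipschitzAtZero_of_histJump` ((AF-1)'s letter),
   `af0_face_of_histJump` ((AF-0@face) with 2·(b∕2)), `betaLowerH_of_histJump` (b), `betaUpperH_of_histJump` (b + γ³), **`betaPertH_of_histJump`**
   (`BetaPertH S.β b`), `split_letters_of_histJump` (a pair β = β⁰ + β¹ with (AF-0), (AF-1), vanishing at the face);
   and **`not_betaContH_of_jump`**: if J vanishes along a sequence converging to a point of ]0, γ] where J ≠ 0, (C) FAILS on ]0, γ]².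
NOT CLAIMED: anything about Bałaban's β; that the family is a lattice object; Theorem 2; continuum; Clay.
-/

namespace Summit.QuantumFields.BalabanUV.Beta.EriceFlowEnclosureB12AsPrintedHistoryJump

open Filter Topology
open Literature.MathematicalPhysics.QuantumFieldTheory.Balaban1983to89
open Literature.MathematicalPhysics.QuantumFieldTheory.Balaban1983to89.B12BetaAsPrinted
open Literature.MathematicalPhysics.QuantumFieldTheory.Balaban1983to89.FlowStep (prefixOf Box mem_box BetaContH BetaLowerH
  BetaUpperH BetaPertH)
open Literature.MathematicalPhysics.QuantumFieldTheory.Balaban1983to89.BetaDerivClause (LastVarLipschitz LastVarLipschitzAtZero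
  atZero_of_lastVarLipschitz)
open Literature.MathematicalPhysics.QuantumFieldTheory.Balaban1983to89.B12CouplingClausesHistory (BetaSmoothInLast264
  BetaAnalyticInLast264 BetaDerivsBoundedInLast264 BetaDerivsUniformInLast264 betaDerivsBoundedInLast264_of_uniform)

noncomputable section

/-! ## §1 Affine last-variable sections -/

/-- All derivatives within [0, γ] of an affine map: order n ≥ 1 of s ↦ b + a·s is a at n = 1 and 0 beyond. [folklore] -/
theorem iteratedDerivWithin_affine {γ : ℝ} (hγ : 0 < γ) (a b : ℝ) {n : ℕ} (hn : 0 < n) {s : ℝ} (hs : s ∈ Set.Icc (0 : ℝ) γ) :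
    iteratedDerivWithin n (fun z : ℝ => b + a * z) (Set.Icc 0 γ) s = if n = 1 then a else 0 := by
  rw [iteratedDerivWithin_const_add hn, iteratedDerivWithin_const_mul_field,
    iteratedDerivWithin_fun_id hs (uniqueDiffOn_Icc hγ)]
  have hn0 : n ≠ 0 := hn.ne'
  by_cases h1 : n = 1
  · simp [h1]
  · simp [hn0, h1]

/-- Smoothness of an affine map. [folklore] -/
theorem contDiff_affine (a b : ℝ) {n : WithTop ℕ∞} : ContDiff ℝ n (fun z : ℝ => b + a * z) :=
  contDiff_const.add (contDiff_const.mul contDiff_id)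

/-- Analyticity of an affine map on any set. [folklore] -/
theorem analyticOn_affine (a b : ℝ) (t : Set ℝ) : AnalyticOn ℝ (fun z : ℝ => b + a * z) t :=
  (analyticOn_const.add (analyticOn_const.mul analyticOn_id))

variable {S : Setting} {b : ℝ} {J : ℝ → ℝ}

/-- Under the defining hypothesis, β_{k+1}(g₀, …, g_k) = b + a_k(g₀)·g_k with slope a_k(g₀) = J(g₀) at k = 1 and 0 otherwise. [folklore] -/
theorem beta_eq (hβ : ∀ (k : ℕ) (p : Fin (k + 1) → ℝ), S.β k p = b + (if k = 1 then J (p 0) else 0) * p (Fin.last k))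
    (k : ℕ) (p : Fin (k + 1) → ℝ) : S.β k p = b + (if k = 1 then J (p 0) else 0) * p (Fin.last k) :=
  hβ k p

/-- The last-variable section of β_{k+1} at ANY frozen history is the affine map s ↦ b + a_k(g₀)·s (moving the last coupling does not
move g₀: at k = 1 the index 0 is not the last one; at k ≠ 1 the slope is 0). [folklore] -/
theorem section_eq (hβ : ∀ (k : ℕ) (p : Fin (k + 1) → ℝ), S.β k p = b + (if k = 1 then J (p 0) else 0) * p (Fin.last k))
    (k : ℕ) (p : Fin (k + 1) → ℝ) :
    (fun s : ℝ => S.β k (Function.update p (Fin.last k) s)) = fun s : ℝ => b + (if k = 1 then J (p 0) else 0) * s := by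
  funext s
  rw [hβ, Function.update_self]
  by_cases hk : k = 1
  · subst hk
    have h0 : (0 : Fin (1 + 1)) ≠ Fin.last 1 := by decide
    rw [Function.update_of_ne h0]
  · simp [hk]

/-- … in particular along a run (`lastSection`): slope J(g₀) at step 2 (g₀ = the run's bare coupling), 0 otherwise. [folklore] -/
theorem lastSection_eq (hβ : ∀ (k : ℕ) (p : Fin (k + 1) → ℝ), S.β k p = b + (if k = 1 then J (p 0) else 0) * p (Fin.last k))
    (P : B12.RunParams) (j : ℕ) :
    lastSection S P j = fun s : ℝ => b + (if j = 1 then J (S.cpl P 0) else 0) * s := by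
  have h := section_eq hβ j (prefixOf (S.cpl P) j)
  simp only [FlowStep.prefixOf_apply] at h
  exact h

/-- THE FACE VALUE IS HISTORY-FREE: β_{k+1}(g₀, …, g_{k−1}, 0) = b (so the printed one-loop numbers of this family are all b, whatever J
does to the preceding couplings — as `Definitions.d213` forces of any setting). [folklore] -/
theorem face_eq (hβ : ∀ (k : ℕ) (p : Fin (k + 1) → ℝ), S.β k p = b + (if k = 1 then J (p 0) else 0) * p (Fin.last k))
    (k : ℕ) (p : Fin (k + 1) → ℝ) : S.β k (Function.update p (Fin.last k) 0) = b := by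
  have h := congrFun (section_eq hβ k p) 0
  simp only [mul_zero, add_zero] at h
  exact h

/-- The slope is between 0 and g₀² when 0 ≤ J ≤ x². [folklore] -/
theorem slope_bounds (hJ0 : ∀ x, 0 ≤ J x) (hJsq : ∀ x, J x ≤ x ^ 2) (k : ℕ) (x : ℝ) :
    0 ≤ (if k = 1 then J x else 0) ∧ (if k = 1 then J x else 0) ≤ x ^ 2 := by
  by_cases hk : k = 1
  · simp only [hk, if_true]; exact ⟨hJ0 x, hJsq x⟩
  · simp only [hk, if_false]; exact ⟨le_rfl, sq_nonneg x⟩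

/-- On a box ]0, γ]^{k+1} the slope is at most γ². [folklore] -/
theorem slope_le_of_box (hJ0 : ∀ x, 0 ≤ J x) (hJsq : ∀ x, J x ≤ x ^ 2) {γ : ℝ} {k : ℕ} {p : Fin (k + 1) → ℝ}
    (hp : p ∈ Box γ k) : 0 ≤ (if k = 1 then J (p 0) else 0) ∧ (if k = 1 then J (p 0) else 0) ≤ γ ^ 2 := by
  obtain ⟨h0, hsq⟩ := slope_bounds hJ0 hJsq k (p 0)
  have hp0 := (mem_box.1 hp) 0
  exact ⟨h0, hsq.trans (pow_le_pow_left₀ hp0.1.le hp0.2 2)⟩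

/-! ## §2 The letters: every last-variable clause (k-uniformly), the size letters, `BetaPertH`; and where (C) fails -/

/-- **p. 264 «smooth on [0, γ]», HISTORY-EXPLICIT, holds** (`BetaSmoothInLast264`, every box size): affine sections. [cite: Balaban1987RG1, p.264 (β-clause after (1.22))] -/
theorem betaSmoothInLast264_of_histJump
    (hβ : ∀ (k : ℕ) (p : Fin (k + 1) → ℝ), S.β k p = b + (if k = 1 then J (p 0) else 0) * p (Fin.last k)) (γ : ℝ) :
    BetaSmoothInLast264 γ S.β := by
  intro k p _ n
  rw [section_eq hβ]
  exact (contDiff_affine _ _).contDiffOn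

/-- **p. 264 «(or analytic)», HISTORY-EXPLICIT, holds** (`BetaAnalyticInLast264`, every box size). [cite: Balaban1987RG1, p.264 (β-clause after (1.22)) with p.266] -/
theorem betaAnalyticInLast264_of_histJump
    (hβ : ∀ (k : ℕ) (p : Fin (k + 1) → ℝ), S.β k p = b + (if k = 1 then J (p 0) else 0) * p (Fin.last k)) (γ : ℝ) :
    BetaAnalyticInLast264 γ S.β := by
  intro k p _
  rw [section_eq hβ]
  exact analyticOn_affine _ _ _

/-- **p. 264 «uniformly bounded on this interval together with all derivatives» in its STRONGEST typed reading holds**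
(`BetaDerivsUniformInLast264`: ONE table for all orders, scales and frozen histories): order 0 ≤ b + γ³, order 1 ≤ γ², orders ≥ 2
vanish (0 < γ, 0 ≤ b, 0 ≤ J ≤ x²). [cite: Balaban1987RG1, p.264 (β-clause after (1.22)) with p.263 («absolute constants»)] -/
theorem betaDerivsUniformInLast264_of_histJump
    (hβ : ∀ (k : ℕ) (p : Fin (k + 1) → ℝ), S.β k p = b + (if k = 1 then J (p 0) else 0) * p (Fin.last k))
    (hb : 0 ≤ b) (hJ0 : ∀ x, 0 ≤ J x) (hJsq : ∀ x, J x ≤ x ^ 2) {γ : ℝ} (hγ : 0 < γ) :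
    BetaDerivsUniformInLast264 γ S.β (fun n => if n = 0 then b + γ ^ 3 else if n = 1 then γ ^ 2 else 0) := by
  intro n k p hp s hs
  rw [section_eq hβ]
  obtain ⟨ha0, haγ⟩ := slope_le_of_box hJ0 hJsq hp
  by_cases hn : n = 0
  · subst hn
    simp only [iteratedDerivWithin_zero, if_true, Real.norm_eq_abs]
    rw [abs_of_nonneg (by nlinarith [hs.1])]
    nlinarith [hs.1, hs.2, hγ]
  · rw [iteratedDerivWithin_affine hγ _ _ (Nat.pos_of_ne_zero hn) hs]
    simp only [hn, if_false]
    by_cases h1 : n = 1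
    · simp only [h1, if_true, Real.norm_eq_abs]; rwa [abs_of_nonneg ha0]
    · simp [h1]

/-- … hence the WEAKEST reading (`BetaDerivsBoundedInLast264`, per scale ∕ history ∕ order) holds too. [cite: Balaban1987RG1, p.264 (β-clause after (1.22))] -/
theorem betaDerivsBoundedInLast264_of_histJump
    (hβ : ∀ (k : ℕ) (p : Fin (k + 1) → ℝ), S.β k p = b + (if k = 1 then J (p 0) else 0) * p (Fin.last k))
    (hb : 0 ≤ b) (hJ0 : ∀ x, 0 ≤ J x) (hJsq : ∀ x, J x ≤ x ^ 2) {γ : ℝ} (hγ : 0 < γ) :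
    BetaDerivsBoundedInLast264 γ S.β :=
  betaDerivsBoundedInLast264_of_uniform (betaDerivsUniformInLast264_of_histJump hβ hb hJ0 hJsq hγ)

/-- **THE β-CLAUSE OF p. 264 AS TYPED (`Conclusions.c264`) HOLDS along every run Theorem 3 speaks of — INCLUDING ITS ANALYTIC MEMBER
under the p. 266 cut-off flag** (the interface dictionary `smooth264_of_box ∕ analytic264_of_box ∕ derivBound264_of_box` fed by the
box-wide schemata; `0 < S.γ`). [cite: Balaban1987RG1, p.264 (β-clause after (1.22)) with p.266] -/
theorem c264_of_histJump
    (hβ : ∀ (k : ℕ) (p : Fin (k + 1) → ℝ), S.β k p = b + (if k = 1 then J (p 0) else 0) * p (Fin.last k))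
    (hb : 0 ≤ b) (hJ0 : ∀ x, 0 ≤ J x) (hJsq : ∀ x, J x ≤ x ^ 2) (hγ : 0 < S.γ)
    (P : B12.RunParams) (hP : RunHyp S P) (j : ℕ) (hj : j + 1 ≤ P.K) :
    (∀ n : ℕ, ContDiffOn ℝ n (lastSection S P j) (Set.Icc 0 S.γ)) ∧
      (S.altCutoff266 → AnalyticOn ℝ (lastSection S P j) (Set.Icc 0 S.γ)) ∧
      (∀ n : ℕ, ∃ B : ℝ, ∀ s ∈ Set.Icc (0 : ℝ) S.γ, ‖iteratedDerivWithin n (lastSection S P j) (Set.Icc 0 S.γ) s‖ ≤ B) :=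
  ⟨fun n => smooth264_of_box (betaSmoothInLast264_of_histJump hβ S.γ) hP.inInterval hj n,
    fun _ => analytic264_of_box (betaAnalyticInLast264_of_histJump hβ S.γ) hP.inInterval hj,
    fun n => derivBound264_of_box (betaDerivsBoundedInLast264_of_histJump hβ hb hJ0 hJsq hγ) hP.inInterval hj n⟩

/-- **ROW I1's k-UNIFORM LAST-VARIABLE LIPSCHITZ LETTER HOLDS** (`BetaDerivClause.LastVarLipschitz S.β (γ²) γ` — the located UNPRINTED
uniformity of [I] p. 264's clause, first order): the sections are affine with slope ≤ γ². [cite: Balaban1987RG1, p.264 (β-clause after (1.22))] -/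
theorem lastVarLipschitz_of_histJump
    (hβ : ∀ (k : ℕ) (p : Fin (k + 1) → ℝ), S.β k p = b + (if k = 1 then J (p 0) else 0) * p (Fin.last k))
    (hJ0 : ∀ x, 0 ≤ J x) (hJsq : ∀ x, J x ≤ x ^ 2) (γ : ℝ) : LastVarLipschitz S.β (γ ^ 2) γ := by
  intro k p hp s t _ _
  have hp' : p ∈ Box γ k := (FlowStep.histBox_eq_box γ k) ▸ hp
  obtain ⟨ha0, haγ⟩ := slope_le_of_box hJ0 hJsq hp'
  have ht := congrFun (section_eq hβ k p) t
  have hs := congrFun (section_eq hβ k p) s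
  rw [ht, hs, show b + (if k = 1 then J (p 0) else 0) * t - (b + (if k = 1 then J (p 0) else 0) * s) =
    (if k = 1 then J (p 0) else 0) * (t - s) by ring, abs_mul, abs_of_nonneg ha0]
  exact mul_le_mul_of_nonneg_right haγ (abs_nonneg _)

/-- … hence (AF-1)'s letter `LastVarLipschitzAtZero S.β (γ²) γ` (row an4's (L@0)). [cite: Balaban1987RG1, p.264 (β-clause after (1.22)) with (2.12)–(2.14) p.268] -/
theorem lastVarLipschitzAtZero_of_histJump
    (hβ : ∀ (k : ℕ) (p : Fin (k + 1) → ℝ), S.β k p = b + (if k = 1 then J (p 0) else 0) * p (Fin.last k))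
    (hJ0 : ∀ x, 0 ≤ J x) (hJsq : ∀ x, J x ≤ x ^ 2) (γ : ℝ) : LastVarLipschitzAtZero S.β (γ ^ 2) γ :=
  atZero_of_lastVarLipschitz (lastVarLipschitz_of_histJump hβ hJ0 hJsq γ)

/-- **(AF-0@face) HOLDS with the one-loop number b = 2·(b∕2)**: β_{k+1}(g₀, …, g_{k−1}, 0) = b at every history (the letter of
`B12AsPrintedRowD4JunctionThm2.theorem2Statement_of_faceLetters ∕ _of_uniform264`). [cite: Balaban1987RG1, (2.12)–(2.14) p.268] -/
theorem af0_face_of_histJump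
    (hβ : ∀ (k : ℕ) (p : Fin (k + 1) → ℝ), S.β k p = b + (if k = 1 then J (p 0) else 0) * p (Fin.last k))
    (γ : ℝ) (k : ℕ) (p : Fin (k + 1) → ℝ) (_hp : p ∈ B12Beta.HistBox γ k) :
    2 * (b / 2) ≤ S.β k (Function.update p (Fin.last k) 0) := by
  rw [face_eq hβ]; linarith

/-- **THE LOWER LETTER (AF) HOLDS**: `b ≤ β_{k+1}` on every box (J ≥ 0). [cite: Balaban1987RG1, Thm 2 (0.31) p.259] -/
theorem betaLowerH_of_histJump
    (hβ : ∀ (k : ℕ) (p : Fin (k + 1) → ℝ), S.β k p = b + (if k = 1 then J (p 0) else 0) * p (Fin.last k))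
    (hJ0 : ∀ x, 0 ≤ J x) (hJsq : ∀ x, J x ≤ x ^ 2) (γ : ℝ) : BetaLowerH b γ S.β := by
  intro k v hv
  rw [hβ]
  have hl := (mem_box.1 hv) (Fin.last k)
  nlinarith [(slope_bounds hJ0 hJsq k (v 0)).1, hl.1]

/-- **THE UPPER LETTER (U) HOLDS box-wide**: `β_{k+1} ≤ b + γ³` on ]0, γ]^{k+1}. [cite: Balaban1987RG1, p.264 («uniformly bounded»)] -/
theorem betaUpperH_of_histJump
    (hβ : ∀ (k : ℕ) (p : Fin (k + 1) → ℝ), S.β k p = b + (if k = 1 then J (p 0) else 0) * p (Fin.last k))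
    (hJ0 : ∀ x, 0 ≤ J x) (hJsq : ∀ x, J x ≤ x ^ 2) {γ : ℝ} (hγ : 0 < γ) : BetaUpperH (b + γ ^ 3) γ S.β := by
  intro k v hv
  rw [hβ]
  obtain ⟨ha0, haγ⟩ := slope_le_of_box hJ0 hJsq hv
  have hl := (mem_box.1 hv) (Fin.last k)
  nlinarith [hl.1, hl.2]

/-- **THE β SUB-CELL'S WALL `FlowStep.BetaPertH S.β b` HOLDS** (γ₀ = 1, C = 1): |β_{k+1}(g₀, …, g_k) − b| = a_k(g₀)·g_k ≤ γ²·γ ≤ γ² on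
]0, γ]^{k+1}, γ ≤ 1 — a k-INDEPENDENT leading coefficient b with an O(γ²) remainder, the cell's first typing of
[Balaban1989LargeFieldII] p. 355's «second order perturbative calculations». [cite: Balaban1989LargeFieldII, p.355] -/
theorem betaPertH_of_histJump
    (hβ : ∀ (k : ℕ) (p : Fin (k + 1) → ℝ), S.β k p = b + (if k = 1 then J (p 0) else 0) * p (Fin.last k))
    (hJ0 : ∀ x, 0 ≤ J x) (hJsq : ∀ x, J x ≤ x ^ 2) : BetaPertH S.β b := by
  refine ⟨1, one_pos, 1, zero_le_one, fun γ hγ hγ1 k v hv => ?_⟩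
  rw [hβ, add_sub_cancel_left]
  obtain ⟨ha0, haγ⟩ := slope_le_of_box hJ0 hJsq hv
  have hl := (mem_box.1 hv) (Fin.last k)
  rw [abs_of_nonneg (mul_nonneg ha0 hl.1.le)]
  calc (if k = 1 then J (v 0) else 0) * v (Fin.last k) ≤ γ ^ 2 * γ := mul_le_mul haγ hl.2 hl.1.le (sq_nonneg γ)
    _ ≤ 1 * γ ^ 2 := by nlinarith

/-- **THE ONE-LOOP SPLIT LETTERS HOLD**: with β⁰_{k+1} := b and β¹_{k+1}(g₀, …, g_k) := a_k(g₀)·g_k one has β = β⁰ + β¹, β¹ = 0 at every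
last-zero history, (AF-0) `2·(b∕2) ≤ β⁰`, (AF-1) `|β¹_{k+1}| ≤ γ²·g_k` on ]0, γ]^{k+1} — every letter of
`…B12AsPrintedUpper.theorem2Statement_of_split` ∕ an4's `theorem2Statement_of_splitPair` except (C). [cite: Balaban1987RG1, (2.12)–(2.14) p.268] -/
theorem split_letters_of_histJump
    (hβ : ∀ (k : ℕ) (p : Fin (k + 1) → ℝ), S.β k p = b + (if k = 1 then J (p 0) else 0) * p (Fin.last k))
    (hJ0 : ∀ x, 0 ≤ J x) (hJsq : ∀ x, J x ≤ x ^ 2) (γ : ℝ) :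
    (∀ (k : ℕ) (p : Fin (k + 1) → ℝ),
      S.β k p = (fun _ : ℕ => b) k + (fun (k : ℕ) (p : Fin (k + 1) → ℝ) => (if k = 1 then J (p 0) else 0) * p (Fin.last k)) k p) ∧
    (∀ (k : ℕ) (p : Fin (k + 1) → ℝ), p (Fin.last k) = 0 → (if k = 1 then J (p 0) else 0) * p (Fin.last k) = 0) ∧
    (∀ k : ℕ, 2 * (b / 2) ≤ (fun _ : ℕ => b) k) ∧
    (∀ (k : ℕ) (p : Fin (k + 1) → ℝ), p ∈ B12Beta.HistBox γ k → |(if k = 1 then J (p 0) else 0) * p (Fin.last k)| ≤ γ ^ 2 * p (Fin.last k)) := by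
  refine ⟨fun k p => hβ k p, fun k p h => by rw [h, mul_zero], fun k => by linarith, fun k p hp => ?_⟩
  have hp' : p ∈ Box γ k := (FlowStep.histBox_eq_box γ k) ▸ hp
  obtain ⟨ha0, haγ⟩ := slope_le_of_box hJ0 hJsq hp'
  have hl := (mem_box.1 hp') (Fin.last k)
  rw [abs_of_nonneg (mul_nonneg ha0 hl.1.le)]
  exact mul_le_mul_of_nonneg_right haγ hl.1.le

/-- **WHERE (C) FAILS.**  If J(x₀) ≠ 0 at some x₀ ∈ ]0, γ] while J vanishes along a sequence u_j → x₀ inside ]0, γ], then β₂ is NOT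
continuous on the box ]0, γ]² at (x₀, x₀): along (u_j, x₀) it is constantly b, at (x₀, x₀) it is b + J(x₀)·x₀ ≠ b.  So `FlowStep.BetaContH γ S.β`
— the binder (C) of every Theorem-2 reduction on this carrier — FAILS for the family, although every letter above holds. [cite: Balaban1987RG1, p.298 («depends also on all preceding coupling constants»)] -/
theorem not_betaContH_of_jump
    (hβ : ∀ (k : ℕ) (p : Fin (k + 1) → ℝ), S.β k p = b + (if k = 1 then J (p 0) else 0) * p (Fin.last k))
    {γ x₀ : ℝ} (hx₀ : 0 < x₀) (hx₀γ : x₀ ≤ γ) (hJx₀ : J x₀ ≠ 0) {u : ℕ → ℝ}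
    (hu : ∀ j, 0 < u j ∧ u j ≤ γ ∧ J (u j) = 0) (hlim : Tendsto u atTop (𝓝 x₀)) : ¬ BetaContH γ S.β := by
  intro hC
  -- the point (x₀, x₀) of the box ]0, γ]² and the sequence (u_j, x₀) inside the box
  set p : Fin (1 + 1) → ℝ := fun _ => x₀ with hp
  have hpmem : p ∈ Box γ 1 := mem_box.2 fun _ => ⟨hx₀, hx₀γ⟩
  set q : ℕ → (Fin (1 + 1) → ℝ) := fun j => Function.update p 0 (u j) with hq
  have hqmem : ∀ j, q j ∈ Box γ 1 := by
    intro j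
    refine mem_box.2 fun i => ?_
    by_cases hi : i = 0
    · subst hi; simp only [hq, Function.update_self]; exact ⟨(hu j).1, (hu j).2.1⟩
    · simp only [hq, Function.update_of_ne hi, hp]; exact ⟨hx₀, hx₀γ⟩
  have hqlim : Tendsto q atTop (𝓝 p) := by
    rw [tendsto_pi_nhds]
    intro i
    by_cases hi : i = 0
    · subst hi; simp only [hq, Function.update_self, hp]; exact hlim
    · simp only [hq, Function.update_of_ne hi]; exact tendsto_const_nhds
  have hcont : ContinuousWithinAt (S.β 1) (Box γ 1) p := hC 1 p hpmem
  have himg : Tendsto (fun j => S.β 1 (q j)) atTop (𝓝 (S.β 1 p)) :=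
    hcont.tendsto.comp (tendsto_nhdsWithin_iff.2 ⟨hqlim, Eventually.of_forall fun j => hqmem j⟩)
  -- the images are constantly b
  have hval : ∀ j, S.β 1 (q j) = b := by
    intro j
    rw [hβ]
    have h0 : q j 0 = u j := by simp [hq]
    simp only [if_true, h0, (hu j).2.2, zero_mul, add_zero]
  have hp1 : S.β 1 p = b + J x₀ * x₀ := by rw [hβ]; simp [hp]
  have hb : Tendsto (fun j => S.β 1 (q j)) atTop (𝓝 b) := by
    simp_rw [hval]; exact tendsto_const_nhds
  have heq := tendsto_nhds_unique himg hb
  rw [hp1] at heq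
  have : J x₀ * x₀ = 0 := by linarith
  rcases mul_eq_zero.1 this with h | h
  · exact hJx₀ h
  · exact hx₀.ne' h

end

end Summit.QuantumFields.BalabanUV.Beta.EriceFlowEnclosureB12AsPrintedHistoryJump
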